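import Mathlib
import Summits.NavierStokesRegularity.NavierStokesRegularity.Theorems.LocalIrrotationalScarDoorZoomFrameSuitable
import Literature.Analysis.FluidPDE.SlabPressureNormalization
import Literature.Analysis.FluidPDE.LocalTypeISlabProfile
import HarnessLib

/-!
# Crux `AveragedConeLiouville` (stmt-NavierStokesRegularity-26889, route AxisTwistDoor), line `lrt_shell` v2, stub (0)
# `stub_zoomToSlackFree` — part 1: THE ZOOM FRAME OF AN ENERGY-CLASS PROFILE AT ITS SINGULAR ORIGIN

`--supports stmt-NavierStokesRegularity-26889` (helper).  Author: prover seat `ns-el-k1b` (g0), width seat 3 under LEAD ns-atd-p1.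

`stub_zoomToSlackFree` zooms an energy-class profile `(v, π, H)` (Type-I rate, continuous, Oseen-mild, divergence free, slab
suitable with weak gradient, `𝐈 < ∞`, backward singular at `(0,0)`) INTO ITSELF at the singular origin, to kill the slack `M` of the
cone hypothesis.  This file provides the frame, exactly as the tree's `localTreeZoomFrame_suitable` (steps (5)–(9), (11)) does for
the half-zoom of a classical solution — here the input is the PROFILE itself (no Leray–Hopf datum, no first zoom): the pressure is
normalised to unit-ball mean zero (`IsSuitableWeakSolutionOn.sub_unitBallMean_slab`, `𝐈` unchanged), the profile is a suitable weak
solution in the balls `Q(0,a)`, `a ≥ 1` (`isSuitableWeakSolutionInBall_of_slab`), Seregin's zoom-in extraction at the singular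
origin (`Seregin2020.exists_ancientLimit`) gives scales `λⱼ → 0⁺` and an `L³_loc` limit `w` of the zooms `λⱼ v(λⱼ² ·, λⱼ ·)` with
pressure `ϖ`, `slab_typeIBound_of_zoomLimit` its slab class with weak gradient `H'` and `𝐈 ≤ 4𝐈(Q(0,1))`, `ae_rate_of_zoomLimit_of_ball`
the rate a.e., `exists_profile_repr` a representative `v₁ = w` a.e. in the profile class (rate, continuity, Oseen-mild,
divergence free) which is backward singular, and `Seregin2020.typeI_singular_scaledEnergies` the pressure energies `cknD ≤ Ks` on
small balls (input of the interior vorticity upgrade).  WHAT THIS IS NOT: not the stub (the sign and the slack-free cone of the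
limit are part 2); nothing about NS regularity (a compactness lemma about HYPOTHETICAL singular profiles).
-/

noncomputable section

set_option linter.dupNamespace false

namespace Summit.NavierStokesRegularity.NavierStokesRegularity.Theorems.AveragedConeLiouvilleProfileZoom

open MeasureTheory Set Function Filter Topology TopologicalSpace Metric
open Literature.Analysis Literature.Analysis.FluidPDE Literature.Analysis.FluidPDE.SereginSverak2009
open Summit.NavierStokesRegularity.NavierStokesRegularity.Theorems
open Summit.NavierStokesRegularity.NavierStokesRegularity.Theorems.LocalSineTubeDoorLocalPointZoomZoom
open Summit.NavierStokesRegularity.NavierStokesRegularity.Theorems.LocalSineTubeDoorLocalPointZoomRate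
open scoped NNReal ENNReal

/-- **The zoom frame of an energy-class profile at its singular origin** (tree `localTreeZoomFrame_suitable`, steps (5)–(9),(11),
run on the profile itself with the pressure normalised to unit-ball mean zero). [cite: AlbrittonBarker2019, §2–3; Seregin2014, Prop. 6.20] -/
theorem profileZoomFrame {C : ℝ} (hC : 0 ≤ C)
    {v : ℝ → EuclideanSpace ℝ (Fin 3) → EuclideanSpace ℝ (Fin 3)} {π : ℝ → EuclideanSpace ℝ (Fin 3) → ℝ}
    {H : ℝ → EuclideanSpace ℝ (Fin 3) → EuclideanSpace ℝ (Fin 3) →L[ℝ] EuclideanSpace ℝ (Fin 3)}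
    (hrate : HasTypeITimeDecay C v)
    (hsw : IsSuitableWeakSolutionOn (slab (EuclideanSpace ℝ (Fin 3)) (Iio (0 : ℝ)) isOpen_Iio) 1 0 v π)
    (hwg : HasWeakSpatialGradientOn (slab (EuclideanSpace ℝ (Fin 3)) (Iio (0 : ℝ)) isOpen_Iio) v H)
    (hI : typeIBound (Iio (0 : ℝ) ×ˢ univ) v π H < ⊤)
    (hsing' : IsBackwardSingularPoint v (0 : ℝ × EuclideanSpace ℝ (Fin 3))) :
    ∃ (πn : ℝ → EuclideanSpace ℝ (Fin 3) → ℝ) (lam : ℕ → ℝ) (w v₁ : ℝ → EuclideanSpace ℝ (Fin 3) → EuclideanSpace ℝ (Fin 3)) (ϖ : ℝ → EuclideanSpace ℝ (Fin 3) → ℝ)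
      (H' : ℝ → EuclideanSpace ℝ (Fin 3) → EuclideanSpace ℝ (Fin 3) →L[ℝ] EuclideanSpace ℝ (Fin 3)) (Ks : ℝ≥0) (r₁ : ℝ),
      (∀ t x, πn t x = π t x - ⨍ y in ball (0 : EuclideanSpace ℝ (Fin 3)) 1, π t y) ∧
      (∀ j, 0 < lam j) ∧ Tendsto lam atTop (𝓝 0) ∧
      IsSuitableWeakSolutionInBall 1 0 v πn ∧ 0 < r₁ ∧ r₁ ≤ 1 ∧
      (∀ r ∈ Ioc (0 : ℝ) r₁, cknD r (0 : ℝ × EuclideanSpace ℝ (Fin 3)) πn ≤ Ks) ∧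
      (∀ a : ℝ, 0 < a → Tendsto (fun j => eLpNorm
        (uncurry ((lam j) • stPull ((lam j) ^ 2) (lam j) (0 : ℝ) (0 : EuclideanSpace ℝ (Fin 3)) v) - uncurry w) 3
        (volume.restrict (parabolicCylinder a (0 : ℝ × EuclideanSpace ℝ (Fin 3))))) atTop (𝓝 0)) ∧
      (IsSuitableWeakSolutionOn (slab (EuclideanSpace ℝ (Fin 3)) (Iio 0) isOpen_Iio) 1 0 w ϖ ∧
        HasWeakSpatialGradientOn (slab (EuclideanSpace ℝ (Fin 3)) (Iio 0) isOpen_Iio) w H' ∧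
        typeIBound (Iio (0 : ℝ) ×ˢ univ) w ϖ H' < ⊤ ∧
        IsBackwardSingularPoint w (0 : ℝ × EuclideanSpace ℝ (Fin 3))) ∧
      (∀ᵐ x ∂(volume.restrict (Iio (0 : ℝ) ×ˢ (univ : Set (EuclideanSpace ℝ (Fin 3))))), uncurry w x = uncurry v₁ x) ∧
      (HasTypeITimeDecay C v₁ ∧ ContinuousOn (uncurry v₁) (Iio (0 : ℝ) ×ˢ univ) ∧
        (∀ s t : ℝ, s < t → t < 0 → ∀ x, v₁ t x =
          UnboundedOperators.heatExtension (v₁ s) (t - s) x - oseenDuhamel 1 s v₁ v₁ t x) ∧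
        (∀ t < 0, VectorCalculus.IsDivFree (v₁ t))) ∧
      IsBackwardSingularPoint v₁ 0 := by
  have hItop : typeIBound (Iio (0 : ℝ) ×ˢ univ) v π H ≠ ⊤ := hI.ne
  -- ## pressure normalised to unit-ball mean zero
  set πn : ℝ → EuclideanSpace ℝ (Fin 3) → ℝ := fun t x => π t x - ⨍ y in ball (0 : EuclideanSpace ℝ (Fin 3)) 1, π t y with hπn
  have hswn : IsSuitableWeakSolutionOn (slab (EuclideanSpace ℝ (Fin 3)) (Iio 0) isOpen_Iio) 1 0 v πn := hsw.sub_unitBallMean_slab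
  have hIn : typeIBound (Iio (0 : ℝ) ×ˢ univ) v πn H = typeIBound (Iio (0 : ℝ) ×ˢ univ) v π H := by
    show typeIBound (Iio (0 : ℝ) ×ˢ univ) v (fun t x => π t x - ⨍ y in ball (0 : EuclideanSpace ℝ (Fin 3)) 1, π t y) H = _
    rw [typeIBound_sub_unitBallMean hsw.distributional.2.2.1]
  have h0n : ∀ t, ⨍ y in ball (0 : EuclideanSpace ℝ (Fin 3)) 1, πn t y = 0 := fun t => unitBallMean_sub_unitBallMean π t
  have hIn' : typeIBound (Iio (0 : ℝ) ×ˢ univ) v πn H ≠ ⊤ := by rw [hIn]; exact hItop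
  -- ## the profile in the balls `Q(0,2) ⊇ Q(0,1)`
  have hball' : IsSuitableWeakSolutionInBall 2 0 v πn := isSuitableWeakSolutionInBall_of_slab hswn hwg hIn' h0n (by norm_num)
  have hH0 : HasWeakSpatialGradientOn (parabolicCylinderOpens 2 (0 : ℝ × EuclideanSpace ℝ (Fin 3))) v H :=
    hwg.mono (parabolicCylinderOpens_le_slab 2 (le_refl (0 : ℝ)))
  have hI' : typeIBound (parabolicCylinder 1 (0 : ℝ × EuclideanSpace ℝ (Fin 3))) v πn H < ⊤ := by
    have hsub : parabolicCylinder 1 (0 : ℝ × EuclideanSpace ℝ (Fin 3)) ⊆ Iio (0 : ℝ) ×ˢ (univ : Set (EuclideanSpace ℝ (Fin 3))) := by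
      intro z hz
      rw [SuitableCompactness.mem_parabolicCylinder_zero] at hz
      exact ⟨hz.1.2, mem_univ _⟩
    refine lt_of_le_of_lt (typeIBound_mono hsub) ?_
    rw [hIn]; exact hI
  set C₁ : ℝ := C with hC₁def
  have hC₁ : 0 ≤ C₁ := hC
  set ρ : ℝ := 1 with hρdef
  set R : ℝ := 1 with hRdef
  have hratev : ∀ s ∈ Ioo (-((1 : ℝ) / (1 / 2 : ℝ) ^ 2)) 0,
      ∀ y ∈ ball (0 : EuclideanSpace ℝ (Fin 3)) ((ρ / R) / (1 / 2 : ℝ)), ‖v s y‖ ≤ C₁ / Real.sqrt (-s) :=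
    fun s hs y _ => hrate s hs.2 y
  -- ## (5) the inputs of the zoom-in extraction on `𝒞 × (−1, 0) ⊆ Q(0, 2)`
  have hsqrt2 : Real.sqrt 2 ≤ 2 := by
    rw [Real.sqrt_le_left (by norm_num)]
    norm_num
  have hPQ : parCyl (0 : ℝ × EuclideanSpace ℝ (Fin 3)) 1 ⊆
      parabolicCylinder 2 (0 : ℝ × EuclideanSpace ℝ (Fin 3)) := by
    intro z hz
    obtain ⟨ht, hx⟩ := hz
    have hx' := spaceCyl_subset_ball (0 : EuclideanSpace ℝ (Fin 3)) zero_le_one hx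
    rw [mul_one, mem_ball_zero_iff] at hx'
    simp only [Prod.fst_zero, one_pow, zero_sub, mem_Ioo] at ht
    rw [SuitableCompactness.mem_parabolicCylinder_zero]
    exact ⟨⟨by linarith [ht.1], ht.2⟩, lt_of_lt_of_le hx' hsqrt2⟩
  have hle : parCylOpens (0 : ℝ × EuclideanSpace ℝ (Fin 3)) 1 ≤
      parabolicCylinderOpens 2 (0 : ℝ × EuclideanSpace ℝ (Fin 3)) := fun z hz => hPQ hz
  have hsw3 : IsSuitableWeakSolutionOn (parCylOpens (0 : ℝ × EuclideanSpace ℝ (Fin 3)) 1) 1 0 v πn :=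
    IsSuitableWeakSolutionOn.mono_holds hball'.1 hle
  have hA3 : ∃ Cc : ℝ≥0, ∀ᵐ t ∂(volume.restrict (Ioo (-1 : ℝ) 0)),
      ∫⁻ x in spaceCyl (0 : EuclideanSpace ℝ (Fin 3)) 1, ‖v t x‖ₑ ^ 2 ≤ Cc := by
    obtain ⟨Cc, hCc⟩ := hball'.2.1
    refine ⟨Cc, ?_⟩
    have hsub : Ioo (-1 : ℝ) 0 ⊆ Ioo ((0 : ℝ × EuclideanSpace ℝ (Fin 3)).1 - 2 ^ 2)
        (0 : ℝ × EuclideanSpace ℝ (Fin 3)).1 := by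
      intro t ht
      simp only [Prod.fst_zero, zero_sub, mem_Ioo]
      exact ⟨by linarith [ht.1], ht.2⟩
    have hballsub : spaceCyl (0 : EuclideanSpace ℝ (Fin 3)) 1 ⊆
        ball (0 : ℝ × EuclideanSpace ℝ (Fin 3)).2 2 := by
      refine (spaceCyl_subset_ball (0 : EuclideanSpace ℝ (Fin 3)) zero_le_one).trans ?_
      rw [mul_one, Prod.snd_zero]
      exact ball_subset_ball hsqrt2
    filter_upwards [ae_restrict_of_ae_restrict_of_subset hsub hCc] with t ht
    exact (lintegral_mono_set hballsub).trans ht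
  have hG3 : HasWeakSpatialGradientOn (parCylOpens (0 : ℝ × EuclideanSpace ℝ (Fin 3)) 1) v H :=
    hH0.mono hle
  have hE3 : ∫⁻ z in parCyl (0 : ℝ × EuclideanSpace ℝ (Fin 3)) 1,
      ENNReal.ofReal (frobeniusNormSq (H z.1 z.2)) < ∞ := by
    obtain ⟨H', hH', hH'2⟩ := hball'.2.2.1
    have hae := hH0.ae_eq hH'
    rw [coe_parabolicCylinderOpens] at hae
    refine lt_of_le_of_lt (lintegral_mono_set hPQ) ?_
    have e : ∫⁻ z in parabolicCylinder 2 (0 : ℝ × EuclideanSpace ℝ (Fin 3)),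
        ENNReal.ofReal (frobeniusNormSq (H z.1 z.2)) =
        ∫⁻ z in parabolicCylinder 2 (0 : ℝ × EuclideanSpace ℝ (Fin 3)),
        ENNReal.ofReal (frobeniusNormSq (H' z.1 z.2)) := by
      refine lintegral_congr_ae ?_
      filter_upwards [hae] with z hz
      have hz' : H z.1 z.2 = H' z.1 z.2 := hz
      rw [hz']
    rw [e]
    exact hH'2
  have hp3 : ∫⁻ z in parCyl (0 : ℝ × EuclideanSpace ℝ (Fin 3)) 1,
      ‖πn z.1 z.2‖ₑ ^ (3 / 2 : ℝ) < ∞ := by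
    obtain ⟨h32, h32', h32r⟩ := threeHalves_facts
    have hm : MemLp (uncurry πn) (3 / 2)
        (volume.restrict (parabolicCylinder 2 (0 : ℝ × EuclideanSpace ℝ (Fin 3)))) := hball'.2.2.2
    have h2 := hm.2
    rw [eLpNorm_eq_lintegral_rpow_enorm_toReal (by norm_num) h32', h32r] at h2
    have hfin : ∫⁻ z in parabolicCylinder 2 (0 : ℝ × EuclideanSpace ℝ (Fin 3)),
        ‖uncurry πn z‖ₑ ^ (3 / 2 : ℝ) < ∞ := by
      by_contra htop
      rw [not_lt, top_le_iff] at htop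
      rw [htop, ENNReal.top_rpow_of_pos (by norm_num)] at h2
      exact lt_irrefl _ h2
    exact lt_of_le_of_lt (lintegral_mono_set hPQ) hfin
  have hI3 : Seregin2020.blowupIndex 0 v H < ∞ := by
    refine lt_of_le_of_lt (Seregin2020.blowupIndex_le_limsup_cknC 0 v H) (lt_of_le_of_lt ?_ hI')
    refine limsup_le_of_le (by isBoundedDefault) ?_
    filter_upwards [Ioo_mem_nhdsGT (zero_lt_one' ℝ)] with r hr
    exact cknC_le_abScaledSum.trans (abScaledSum_le_typeIBound hr.1
      (SuitableCompactness.parabolicCylinder_zero_mono hr.1.le hr.2.le))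
  -- ## (6) the zoom-in limit at the singular origin
  obtain ⟨K, κ, lam, w, ϖ, -, hlam, hlam0, hsingw, hlimw⟩ :=
    Seregin2020.exists_ancientLimit hsw3 hA3 hG3 hE3 hp3 hsing' hI3
  -- ## (7) the slab class with `𝐈 ≤ 4 𝐈(Q(0,1))`
  have hball1 : IsSuitableWeakSolutionInBall 1 0 v πn :=
    SuitableCompactness.isSuitableWeakSolutionInBall_of_le_radius hball' (by norm_num) (by norm_num)
  have hG1 : HasWeakSpatialGradientOn
      (parabolicCylinderOpens 1 (0 : ℝ × EuclideanSpace ℝ (Fin 3))) v H :=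
    hH0.mono (SuitableCompactness.parabolicCylinderOpens_zero_mono (by norm_num) (by norm_num))
  obtain ⟨hsww, H', hH, h4I⟩ := slab_typeIBound_of_zoomLimit
    (typeIBound (parabolicCylinder 1 (0 : ℝ × EuclideanSpace ℝ (Fin 3))) v πn H) hI' one_pos
    hball1 hG1 le_rfl hlam hlam0
    (fun a ha => ⟨(hlimw a ha).1, (hlimw a ha).2.1, (hlimw a ha).2.2.1, (hlimw a ha).2.2.2.1⟩)
  -- ## (8) the rate, almost everywhere on the slab
  have hvm : ∀ a : ℝ, 0 < a → ∀ᶠ j in atTop, AEStronglyMeasurable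
      (uncurry ((lam j) • stPull ((lam j) ^ 2) (lam j) (0 : ℝ) (0 : EuclideanSpace ℝ (Fin 3)) v))
      (volume.restrict (parabolicCylinder a (0 : ℝ × EuclideanSpace ℝ (Fin 3)))) := by
    intro a ha
    have hev : ∀ᶠ j in atTop, lam j < 1 / a := hlam0 (Iio_mem_nhds (by positivity))
    filter_upwards [hev] with j hj
    have hμ := hlam j
    have h := hG1.stRescale (lam j) (pow_pos hμ 2) hμ (0 : ℝ) (0 : EuclideanSpace ℝ (Fin 3))
    have hsub : parabolicCylinder a (0 : ℝ × EuclideanSpace ℝ (Fin 3)) ⊆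
        ((stPreimage ((lam j) ^ 2) (lam j) (0 : ℝ) (0 : EuclideanSpace ℝ (Fin 3))
          (parabolicCylinderOpens 1 (0 : ℝ × EuclideanSpace ℝ (Fin 3))) :
            Opens (ℝ × EuclideanSpace ℝ (Fin 3))) : Set (ℝ × EuclideanSpace ℝ (Fin 3))) := by
      rw [coe_stPreimage, coe_parabolicCylinderOpens, stAffine_preimage_parabolicCylinder_zero hμ]
      refine SuitableCompactness.parabolicCylinder_zero_mono ha.le ?_
      rw [le_div_iff₀ hμ, mul_comm]
      exact ((lt_div_iff₀ ha).1 hj).le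
    exact h.locallyIntegrableOn.aestronglyMeasurable.mono_measure (Measure.restrict_mono hsub le_rfl)
  have hae_rate := ae_rate_of_zoomLimit_of_ball (by positivity : (0 : ℝ) < (1 : ℝ) / (1 / 2 : ℝ) ^ 2)
    (by positivity : (0 : ℝ) < (ρ / R) / (1 / 2 : ℝ)) hratev hlam hlam0 hvm
    (fun a ha => ⟨(hlimw a ha).2.1.1, (hlimw a ha).2.2.1⟩)
  -- ## (9) a representative with the pointwise rate
  have h4top : typeIBound (Iio (0 : ℝ) ×ˢ univ) w ϖ H' < ∞ :=
    lt_of_le_of_lt h4I (ENNReal.mul_lt_top (by simp) hI')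
  obtain ⟨v₁, hae, hP, hsing₁⟩ := exists_profile_repr hC₁ hsww hH h4top hsingw hae_rate
  -- ## (11) Seregin's scaled energies (pressure) at the singular origin of `v`
  obtain ⟨Ks, κ', -, r₁, hr₁, hr₁1, hKs⟩ :=
    Seregin2020.typeI_singular_scaledEnergies hsw3 hA3 hG3 hE3 hp3 hsing' hI3
  exact ⟨πn, lam, w, v₁, ϖ, H', Ks, r₁, fun t x => rfl, hlam, hlam0, hball1, hr₁, hr₁1,
    fun r hr => le_trans le_add_self (hKs r hr).1, fun a ha => (hlimw a ha).2.2.1,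
    ⟨hsww, hH, h4top, hsingw⟩, hae, hP, hsing₁⟩

end Summit.NavierStokesRegularity.NavierStokesRegularity.Theorems.AveragedConeLiouvilleProfileZoom

end
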